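import Mathlib
import HarnessLib

/-!
# Crux `NarrowRunsDie` (stmt-ResolutionOfSingularities-16882, route `WildCones`), line `derivlift` —
# stub `stub_homogNear`

Registered stub of the line skeleton `Cruxes/NarrowRunsDie/Lines/derivlift.lean` (v3), stated over the
route's inlined `let` calculus VERBATIM. See the skeleton docstring of `Sig.stub_homogNear` for the paper proof.

Proof outline. Write `v := Function.update τ i 1`, `g := G(v + u')` (the slice, `u'` the variables
`X j`, `j ≠ i`), and homogenise the slice with the fresh variable `S := X none`:
`P := G(u'' + v S)` where `u''` is `X (some j)` in slot `j ≠ i` and `0` in slot `i`.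
* `P` is a form of degree `p`, and its dehomogenisation `S ↦ 1` is `g`; for a degree-`p` form the
  coefficient at an exponent `m` of degree `p` is the coefficient of the dehomogenisation at `m.some`
  (`homogNear_coeff_dehom`). Hence the hypothesis (no terms of `g` in degrees `1 … p-1`, using that
  `g` is free of `X i`) gives `P = P|_{S=0} + G(v) S^p` (`homogNear_P_decomp`).
* Substituting `X (some j) ↦ Y j` (`Y i = 0`), `S ↦ T` gives `G(Y + vT) = G(Y) + G(v) T^p`
  (`homogNear_shift`).
* With `Y := X - X_i v` (whose `i`-th slot vanishes as `v i = 1`) and `T := S + X_i`, resp. `T := X_i`,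
  subtracting and using `(S + X_i)^p = S^p + X_i^p` (characteristic `p`) gives the claim.
-/

noncomputable section

set_option linter.dupNamespace false

namespace Summit.ResolutionOfSingularities.ResolutionOfSingularities.Theorems.NarrowRunsDie

open MvPolynomial

/-- Coefficients after the substitution `X i₀ ↦ 0`: monomials containing `X i₀` are killed,
all other coefficients are unchanged. -/
theorem homogNear_coeff_kill {σ R : Type*} [CommSemiring R] [DecidableEq σ] (i₀ : σ)
    (q : MvPolynomial σ R) (A : σ →₀ ℕ) :
    coeff A (aeval (fun j => if j = i₀ then (0 : MvPolynomial σ R) else X j) q) =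
      if A i₀ = 0 then coeff A q else 0 := by
  induction q using MvPolynomial.induction_on' with
  | monomial u a =>
    rw [aeval_monomial, algebraMap_eq, Finsupp.prod]
    by_cases hu : u i₀ = 0
    · have h1 : (∏ j ∈ u.support, (if j = i₀ then (0 : MvPolynomial σ R) else X j) ^ u j) =
          monomial u 1 := by
        rw [← prod_X_pow_eq_monomial]
        refine Finset.prod_congr rfl fun j hj => ?_
        rw [if_neg]
        rintro rfl
        exact (Finsupp.mem_support_iff.mp hj) hu
      rw [h1, C_mul_monomial, mul_one, coeff_monomial]
      by_cases hA : A i₀ = 0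
      · rw [if_pos hA]
      · rw [if_neg hA, if_neg]
        rintro rfl
        exact hA hu
    · have h1 : (∏ j ∈ u.support, (if j = i₀ then (0 : MvPolynomial σ R) else X j) ^ u j) = 0 := by
        apply Finset.prod_eq_zero (Finsupp.mem_support_iff.mpr hu)
        rw [if_pos rfl, zero_pow hu]
      rw [h1, mul_zero, coeff_zero, coeff_monomial]
      split_ifs with h2 h3
      · exact (hu (by rw [h3]; exact h2)).elim
      · rfl
      · rfl
  | add p q hp hq =>
    rw [map_add, coeff_add, coeff_add, hp, hq]
    split_ifs <;> simp

/-- The dehomogenisation `X none ↦ 1`, `X (some a) ↦ X a` on monomials. -/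
theorem homogNear_dehom_monomial {α R : Type*} [CommSemiring R] (m : Option α →₀ ℕ) (c : R) :
    aeval (fun o : Option α => o.elim (1 : MvPolynomial α R) X) (monomial m c) =
      monomial m.some c := by
  rw [aeval_monomial, algebraMap_eq, Finsupp.prod_option_index]
  · simp only [Option.elim_none, Option.elim_some, one_pow, one_mul]
    exact monomial_eq.symm
  · intro o
    exact pow_zero _
  · intro o k₁ k₂
    exact pow_add _ _ _

/-- Degree of an exponent vector over `Option α`: the `none` exponent plus the degree of the rest. -/
theorem homogNear_degree_option {α : Type*} [Fintype α] (m : Option α →₀ ℕ) :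
    m.degree = m none + m.some.degree := by
  simp only [Finsupp.degree_eq_sum, Fintype.sum_option, Finsupp.some_apply]

/-- A degree-`e` form is determined coefficientwise by its dehomogenisation `X none ↦ 1`:
its coefficient at an exponent `m` of degree `e` is the coefficient of the dehomogenisation
at `m.some`. -/
theorem homogNear_coeff_dehom {α R : Type*} [Fintype α] [CommSemiring R] {e : ℕ}
    {Q : MvPolynomial (Option α) R} (hQ : Q.IsHomogeneous e) (m : Option α →₀ ℕ)
    (hm : m.degree = e) :
    coeff m Q = coeff m.some (aeval (fun o : Option α => o.elim (1 : MvPolynomial α R) X) Q) := by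
  classical
  conv_rhs => rw [Q.as_sum, map_sum, coeff_sum]
  simp only [homogNear_dehom_monomial, coeff_monomial]
  rw [Finset.sum_eq_single m, if_pos rfl]
  · intro m' hm' hne
    rw [if_neg]
    intro h
    apply hne
    have hd' : m'.degree = e := (hQ.degree_eq_sum_deg_support hm').symm
    have h1 := homogNear_degree_option m'
    have h2 := homogNear_degree_option m
    rw [hd', h] at h1
    rw [hm] at h2
    have h3 : m' none = m none := by omega
    calc m' = m'.some.optionElim (m' none) := (Finsupp.optionElim_some m').symm
      _ = m.some.optionElim (m none) := by rw [h, h3]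
      _ = m := Finsupp.optionElim_some m
  · intro hms
    rw [if_pos rfl]
    exact notMem_support_iff.mp hms

section Main

variable {p n : ℕ} {κ : Type*} [Field κ] (G : MvPolynomial (Fin n) κ) (i : Fin n) (τ : Fin n → κ)

/-- Dehomogenising the homogenised slice `P` gives back the slice `g = G(v + u')`. -/
theorem homogNear_dehom_P :
    aeval (fun o : Option (Fin n) => o.elim (1 : MvPolynomial (Fin n) κ) X)
      (aeval (fun j : Fin n => (if j = i then (0 : MvPolynomial (Option (Fin n)) κ) else X (some j))
        + C (Function.update τ i 1 j) * X none) G)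
    = aeval (fun j : Fin n => if j = i then (1 : MvPolynomial (Fin n) κ) else X j + C (τ j)) G := by
  rw [comp_aeval_apply]
  congr 1
  congr 1
  funext j
  by_cases hj : j = i
  · subst hj
    simp
  · simp [hj]

/-- The slice `g` does not involve `X i`: its coefficients at exponents `A` with `A i ≠ 0` vanish. -/
theorem homogNear_coeff_slice_eq_zero (A : Fin n →₀ ℕ) (hA : A i ≠ 0) :
    coeff A (aeval (fun j : Fin n => if j = i then (1 : MvPolynomial (Fin n) κ) else X j + C (τ j)) G)
      = 0 := by
  have h : aeval (fun j : Fin n => if j = i then (1 : MvPolynomial (Fin n) κ) else X j + C (τ j)) G =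
      aeval (fun j => if j = i then (0 : MvPolynomial (Fin n) κ) else X j)
        (aeval (fun j : Fin n => if j = i then (1 : MvPolynomial (Fin n) κ) else X j + C (τ j)) G) := by
    rw [comp_aeval_apply]
    congr 1
    congr 1
    funext j
    by_cases hj : j = i
    · subst hj
      simp
    · simp [hj]
  rw [h, homogNear_coeff_kill, if_neg hA]

/-- The constant coefficient of the slice `g = G(v + u')` is `G(v)`. -/
theorem homogNear_coeff_zero_slice :
    coeff 0 (aeval (fun j : Fin n => if j = i then (1 : MvPolynomial (Fin n) κ) else X j + C (τ j)) G)
      = eval (Function.update τ i 1) G := by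
  have h1 : ∀ q : MvPolynomial (Fin n) κ, coeff 0 q = aeval (0 : Fin n → κ) q := fun q => by
    rw [aeval_zero, Algebra.algebraMap_self_apply]
    rfl
  rw [h1, comp_aeval_apply, ← aeval_eq_eval]
  congr 1
  congr 1
  funext j
  by_cases hj : j = i
  · subst hj
    simp
  · simp [hj]

/-- The homogenised slice `P = G(u'' + v S)` (`u''` the variables `X (some j)`, `j ≠ i`, with `0`
in slot `i`; `S = X none`) is a form of degree `p`. -/
theorem homogNear_P_isHomogeneous (hG : G.IsHomogeneous p) :
    (aeval (fun j : Fin n => (if j = i then (0 : MvPolynomial (Option (Fin n)) κ) else X (some j))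
        + C (Function.update τ i 1 j) * X none) G).IsHomogeneous p := by
  have hg : ∀ j : Fin n, ((if j = i then (0 : MvPolynomial (Option (Fin n)) κ) else X (some j))
      + C (Function.update τ i 1 j) * X none).IsHomogeneous 1 := by
    intro j
    refine IsHomogeneous.add ?_ ?_
    · split_ifs
      · exact isHomogeneous_zero _ _ _
      · exact isHomogeneous_X _ _
    · simpa only [zero_add] using
        (isHomogeneous_C _ _).mul (isHomogeneous_X _ (none : Option (Fin n)))
  simpa only [one_mul] using hG.aeval _ hg

/-- In degree `p`, the coefficients of the homogenised slice `P` are those of the slice `g`. -/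
theorem homogNear_coeff_P (hG : G.IsHomogeneous p) (m : Option (Fin n) →₀ ℕ)
    (hm : m.degree = p) :
    coeff m (aeval (fun j : Fin n => (if j = i then (0 : MvPolynomial (Option (Fin n)) κ)
        else X (some j)) + C (Function.update τ i 1 j) * X none) G)
      = coeff m.some (aeval (fun j : Fin n => if j = i then (1 : MvPolynomial (Fin n) κ)
          else X j + C (τ j)) G) := by
  rw [homogNear_coeff_dehom (homogNear_P_isHomogeneous G i τ hG) m hm, homogNear_dehom_P]

/-- Splitting of the homogenised slice, `P = P|_{S = 0} + G(v) · S ^ p`, granted that the slice `g`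
has no terms in the degrees strictly between `0` and `p`. -/
theorem homogNear_P_decomp (hp : p.Prime) (hG : G.IsHomogeneous p)
    (hcoef : ∀ A : Fin n →₀ ℕ, A i = 0 → 0 < Finset.sum Finset.univ (fun j => A j) →
      Finset.sum Finset.univ (fun j => A j) < p →
      coeff A (aeval (fun j : Fin n => if j = i then (1 : MvPolynomial (Fin n) κ)
        else X j + C (τ j)) G) = 0) :
    aeval (fun j : Fin n => (if j = i then (0 : MvPolynomial (Option (Fin n)) κ) else X (some j))
        + C (Function.update τ i 1 j) * X none) G
      = aeval (fun o : Option (Fin n) => if o = none then (0 : MvPolynomial (Option (Fin n)) κ)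
            else X o)
          (aeval (fun j : Fin n => (if j = i then (0 : MvPolynomial (Option (Fin n)) κ)
            else X (some j)) + C (Function.update τ i 1 j) * X none) G)
        + C (eval (Function.update τ i 1) G) * X none ^ p := by
  have hPh := homogNear_P_isHomogeneous G i τ hG
  refine MvPolynomial.ext _ _ fun m => ?_
  rw [coeff_add, homogNear_coeff_kill, coeff_C_mul, coeff_X_pow]
  by_cases hdeg : m.degree = p
  · have hsplit := homogNear_degree_option m
    rw [hdeg] at hsplit
    by_cases h0 : m none = 0
    · rw [if_pos h0, if_neg, mul_zero, add_zero]
      intro h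
      rw [← h, Finsupp.single_eq_same] at h0
      exact hp.ne_zero h0
    · rw [if_neg h0, zero_add, homogNear_coeff_P G i τ hG m hdeg]
      by_cases hpn : m none = p
      · have hs0 : m.some = 0 := by
          rw [← Finsupp.degree_eq_zero_iff]
          omega
        have hm : Finsupp.single none p = m := by
          rw [← Finsupp.optionElim_some m, hs0, hpn, Finsupp.optionElim_zero]
        rw [if_pos hm, mul_one, hs0, homogNear_coeff_zero_slice]
      · rw [if_neg, mul_zero]
        · by_cases hi : m.some i = 0
          · apply hcoef _ hi
            · rw [← Finsupp.degree_eq_sum]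
              omega
            · rw [← Finsupp.degree_eq_sum]
              omega
          · exact homogNear_coeff_slice_eq_zero G i τ _ hi
        · intro h
          rw [← h, Finsupp.single_eq_same] at hpn
          exact hpn rfl
  · have hne : Finsupp.single none p ≠ m := fun h => hdeg (by rw [← h, Finsupp.degree_single])
    rw [hPh.coeff_eq_zero hdeg, if_neg hne, mul_zero, add_zero]
    split_ifs <;> rfl

/-- Additive near-invariance along `v` against any centre `Y` with vanishing `i`-th slot:
`G(Y + v T) = G(Y) + G(v) T ^ p`. -/
theorem homogNear_shift (hp : p.Prime) (hG : G.IsHomogeneous p)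
    (hcoef : ∀ A : Fin n →₀ ℕ, A i = 0 → 0 < Finset.sum Finset.univ (fun j => A j) →
      Finset.sum Finset.univ (fun j => A j) < p →
      coeff A (aeval (fun j : Fin n => if j = i then (1 : MvPolynomial (Fin n) κ)
        else X j + C (τ j)) G) = 0)
    (Y : Fin n → MvPolynomial (Option (Fin n)) κ) (hY : Y i = 0)
    (T : MvPolynomial (Option (Fin n)) κ) :
    aeval (fun j : Fin n => Y j + C (Function.update τ i 1 j) * T) G
      = aeval Y G + C (eval (Function.update τ i 1) G) * T ^ p := by
  have hY' : ∀ j, (if j = i then (0 : MvPolynomial (Option (Fin n)) κ) else Y j) = Y j := by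
    intro j
    by_cases hj : j = i
    · subst hj
      simp [hY]
    · simp [hj]
  have h := congrArg (aeval (fun o : Option (Fin n) => o.elim T Y))
    (homogNear_P_decomp G i τ hp hG hcoef)
  simp only [map_add, map_mul, map_pow, aeval_X, aeval_C, algebraMap_eq, Option.elim_none,
    Option.elim_some, comp_aeval_apply, apply_ite, map_zero, reduceCtorEq, if_false, if_true,
    mul_zero, add_zero, hY'] at h
  exact h

end Main

/-- The registered stub statement `Sig.stub_homogNear` of line `derivlift`, VERBATIM the skeleton's
`Sig.stub_homogNear` (`Cruxes/NarrowRunsDie/Lines/derivlift.lean`; restated because `Theorems/` does not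
import `Cruxes/` — the two definitions unfold to the same term, so the skeleton's stub is closed by
`exact Theorems.NarrowRunsDie.stub_homogNear`). -/
def Sig.stub_homogNear : Prop :=
  ∀ p : ℕ, p.Prime → ∀ (n : ℕ) (κ : Type) [Field κ] [CharP κ p]
    (G : MvPolynomial (Fin n) κ) (i : Fin n) (τ : Fin n → κ),
    G.IsHomogeneous p →
    (∀ A : Fin n →₀ ℕ, A i = 0 → 0 < Finset.sum Finset.univ (fun j => A j) →
      Finset.sum Finset.univ (fun j => A j) < p →
      MvPolynomial.coeff A (MvPolynomial.aeval (fun j : Fin n => if j = i then (1 : MvPolynomial (Fin n) κ) else MvPolynomial.X j + MvPolynomial.C (τ j)) G) = 0) →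
    MvPolynomial.aeval (fun j : Fin n => (MvPolynomial.X (some j) : MvPolynomial (Option (Fin n)) κ) + MvPolynomial.C (Function.update τ i 1 j) * MvPolynomial.X none) G
      = MvPolynomial.rename some G + MvPolynomial.C (MvPolynomial.eval (Function.update τ i 1) G) * (MvPolynomial.X none) ^ p

/-- Stub `stub_homogNear` of line `derivlift` for crux `WildCones.NarrowRunsDie`, unfolded statement:
for a form `G` of degree `p` in characteristic `p` and `v = update τ i 1`, if the slice `G(v + u')` has no
terms in degrees `1 … p-1` (among the `X i`-free exponents), then `G(X + v S) = G(X) + G(v) S ^ p`. -/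
theorem homogNear_main :
  ∀ p : ℕ, p.Prime → ∀ (n : ℕ) (κ : Type) [Field κ] [CharP κ p]
    (G : MvPolynomial (Fin n) κ) (i : Fin n) (τ : Fin n → κ),
    G.IsHomogeneous p →
    (∀ A : Fin n →₀ ℕ, A i = 0 → 0 < Finset.sum Finset.univ (fun j => A j) →
      Finset.sum Finset.univ (fun j => A j) < p →
      MvPolynomial.coeff A (MvPolynomial.aeval (fun j : Fin n => if j = i then (1 : MvPolynomial (Fin n) κ) else MvPolynomial.X j + MvPolynomial.C (τ j)) G) = 0) →
    MvPolynomial.aeval (fun j : Fin n => (MvPolynomial.X (some j) : MvPolynomial (Option (Fin n)) κ) + MvPolynomial.C (Function.update τ i 1 j) * MvPolynomial.X none) G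
      = MvPolynomial.rename some G + MvPolynomial.C (MvPolynomial.eval (Function.update τ i 1) G) * (MvPolynomial.X none) ^ p := by
  intro p hp n κ _ _ G i τ hG hcoef
  haveI : Fact p.Prime := ⟨hp⟩
  have key := homogNear_shift G i τ hp hG hcoef
    (fun j => X (some j) - C (Function.update τ i 1 j) * X (some i)) (by simp)
  have h1 : aeval (fun j : Fin n => (X (some j) : MvPolynomial (Option (Fin n)) κ)
        + C (Function.update τ i 1 j) * X none) G
      = aeval (fun j : Fin n => X (some j) - C (Function.update τ i 1 j) * X (some i)) G
        + C (eval (Function.update τ i 1) G) * (X none + X (some i)) ^ p := by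
    convert key (X none + X (some i)) using 2
    congr 1
    funext j
    ring
  have h2 : aeval (fun j : Fin n => (X (some j) : MvPolynomial (Option (Fin n)) κ)) G
      = aeval (fun j : Fin n => X (some j) - C (Function.update τ i 1 j) * X (some i)) G
        + C (eval (Function.update τ i 1) G) * X (some i) ^ p := by
    convert key (X (some i)) using 2
    congr 1
    funext j
    ring
  have hr : rename some G
      = aeval (fun j : Fin n => (X (some j) : MvPolynomial (Option (Fin n)) κ)) G := by
    rw [rename_eq_aeval]
    rfl
  rw [h1, hr, h2, add_pow_char]
  ring

/-- Stub `stub_homogNear` of line `derivlift` for crux `WildCones.NarrowRunsDie` (registered signature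
`Sig.stub_homogNear`, verbatim). -/
theorem stub_homogNear : Sig.stub_homogNear :=
  homogNear_main

end Summit.ResolutionOfSingularities.ResolutionOfSingularities.Theorems.NarrowRunsDie

end
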